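import Summits.Ventures.QEC.Census.CertInfoSetOrbitSound
import Summits.Ventures.QEC.Census.BZAutPermFast
import HarnessLib

/-!
# Orbit-averaged information-set lower bounds — FAST kernel words (one-pass transports, transported free masks)
# (qec-search-4 g4; companion of `Census/CertInfoSetOrbit.lean` / `CertInfoSetOrbitSound.lean`)

The landed lane checks its automorphisms with type-12's `rowMapOK` (word transport `permWord (permFun perm) w n`: one
TABLE LOOKUP per bit, `O(n²)` list steps per row) and recounts the orbit multiplicities from COMPOSED permutation tables
(`wordPerm`: `composeTab`, `O(n²)` per letter; `orbMult`: one table lookup per (qubit, view, automorphism)).  Measured on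
`[[126,28,8]]` (63 shifts): ≈ 300 farm-s of bookkeeping around < 2 s of lane engine; at `n ≈ 250` with `ℓ ≈ 127` shifts
the same words would cost > 10⁷ kernel steps per row.  This file gives FAST TWINS and an abstract soundness theorem:

* (type-12's `Census/BZAutPermFast.lean` already has the one-pass word transport `permWordL` / `wordApplyL` and the fast
  generator check `autGensOKFast` with `autGensOK_of_fast` — reused here;)
* `exists_submatrix_symm` — the INVERSE of a row-map automorphism is a row-map automorphism (finite row set; so a
  support may be transported by `σ⁻¹` as well as by `σ`);
* `freeMaskOf`, `viewMasks` (`σ_w(free)` by type-12's `wordApplyL`), `countMasks`, `multTabOKF`,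
  **`orbitProfileOKF n wmax gens words views cls μ`** — the multiplicity of qubit `x` for view `s` is recounted as
  `#{w : x ∈ σ_w(free_s)} = #{w : σ_w⁻¹(x) free}`, i.e. the orbit multiplicity for the family `(σ_w⁻¹)_w`, at
  `O(n)` per (word letter, view) + `O(q)` per (qubit, view); no permutation table is ever composed;
* `orbit_lower_sound_abs` — the landed argument for an ABSTRACT indexed family of automorphisms `σ_i` with a tabulated
  multiplicity; its fast instance **`orbit_lower_soundF`** is the companion file `CertInfoSetOrbitFastSound.lean` with / `DistCert.lowZ_of_orbitF` / `lowX_of_orbitF` /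
  `dZ_code_of_orbitF` / `dX_code_of_orbitF` (hypotheses: `autGensOKFast`, `autWordsOK`, `infoSetStructOK` per view, the
  per-view replays, `orbitProfileOKF`); `[[4,2,2]]` controls.
HONEST FRAMING: no certificate is read here and no distance value is asserted; tier KERNEL, axioms ⊆ {propext,
Classical.choice, Quot.sound}; no `native_decide`.
-/

set_option autoImplicit false

namespace Summit.Ventures.QEC.Census

open Matrix Literature.InformationTheory.QuantumCodes

/-! ## 1. The inverse of a row-map automorphism -/

/-- If a permutation `σ` of the columns maps the rows of `H` to rows of `H` (`H.submatrix ρ σ = H` for some row map `ρ`),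
then so does `σ⁻¹`: the map `r ↦ r ∘ σ⁻¹` is injective on the finite set of rows and maps it into itself, hence onto. -/
theorem exists_submatrix_symm {m k : ℕ} (H : Matrix (Fin m) (Fin k) (ZMod 2)) (σ : Fin k ≃ Fin k)
    (h : ∃ ρ : Fin m → Fin m, H.submatrix ρ σ = H) : ∃ ρ' : Fin m → Fin m, H.submatrix ρ' σ.symm = H := by
  classical
  obtain ⟨ρ, hρ⟩ := h
  have hrow : ∀ i, H (ρ i) = H i ∘ σ.symm := fun i => by
    funext j
    have := congrFun (congrFun hρ i) (σ.symm j)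
    simpa [Matrix.submatrix_apply] using this
  let S : Finset (Fin k → ZMod 2) := Finset.univ.image fun i => H i
  let f : (Fin k → ZMod 2) → (Fin k → ZMod 2) := fun r => r ∘ σ.symm
  have hf : Function.Injective f := fun r₁ r₂ hr => by
    funext j
    have := congrFun hr (σ j)
    simpa [f] using this
  have hmaps : S.image f ⊆ S := by
    intro r hr
    rw [Finset.mem_image] at hr
    obtain ⟨r', hr', rfl⟩ := hr
    rw [Finset.mem_image] at hr'
    obtain ⟨i, -, rfl⟩ := hr'
    exact Finset.mem_image.2 ⟨ρ i, Finset.mem_univ _, hrow i⟩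
  have heq : S.image f = S :=
    Finset.eq_of_subset_of_card_le hmaps (by rw [Finset.card_image_of_injective _ hf])
  have hex : ∀ i, ∃ i', H i' ∘ σ.symm = H i := fun i => by
    have hi : H i ∈ S.image f := by rw [heq]; exact Finset.mem_image.2 ⟨i, Finset.mem_univ _, rfl⟩
    rw [Finset.mem_image] at hi
    obtain ⟨r, hr, hfr⟩ := hi
    rw [Finset.mem_image] at hr
    obtain ⟨i', -, rfl⟩ := hr
    exact ⟨i', hfr⟩
  choose ρ' hρ' using hex
  refine ⟨ρ', ?_⟩
  ext i j
  rw [Matrix.submatrix_apply]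
  exact congrFun (hρ' i) j

/-! ## 2. Transported free masks and the fast profile check -/

/-- The bitmask of the free columns `< n` of a view. (definition) -/
def freeMaskOf (n : ℕ) (piv : List ℕ) : ℕ := maskOf (freeIdx n piv)

/-- `countMasks Ms x = #{M ∈ Ms : bit x of M}` (one pass). (definition) -/
def countMasks : List ℕ → ℕ → ℕ
  | [], _ => 0
  | M :: Ms, x => (cond (M.testBit x) 1 0) + countMasks Ms x

/-- The transported free masks of a view, one per word. (definition) -/
def viewMasks (n : ℕ) (gens words : List (List ℕ)) (piv : List ℕ) : List ℕ :=
  words.map fun w => wordApplyL n gens w (freeMaskOf n piv)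

/-- **Fast class-table check**: `cls` has length `n`, classes `< |μ|`, and for every qubit `x < n` and view `s`,
`#{w : x ∈ σ_w(free_s)} = μ[cls x][s]`. (definition) -/
def multTabOKF (n : ℕ) (gens words : List (List ℕ)) (views : List OrbitView) (cls : List ℕ) (μ : List (List ℕ)) :
    Bool :=
  (cls.length == n) && ((List.range n).all fun x => decide (cls.getD x 0 < μ.length)) &&
    (List.range views.length).all fun s =>
      (List.range n).all fun x =>
        countMasks (viewMasks n gens words (views.getD s dfltView).ic.piv) x == (μ.getD (cls.getD x 0) []).getD s 0

/-- **The fast orbit-profile check** of one side: fast class table + the profile recursion of the landed lane with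
`q = |words|`. (definition) -/
def orbitProfileOKF (n wmax : ℕ) (gens words : List (List ℕ)) (views : List OrbitView) (cls : List ℕ)
    (μ : List (List ℕ)) : Bool :=
  multTabOKF n gens words views cls μ &&
    profGo μ (classSizes n μ.length cls) wmax 0 (List.replicate views.length 0) (orbBounds words.length views)

section MaskLemmas

variable {n : ℕ}

/-- Bits of the fast word transport (type-12 `wordApplyL`), inverse form: bit `y` of `σ_w(M)` is bit `σ_w⁻¹ y` of `M`
(any `M`: `wordApplyL` reduces modulo `2^n`). -/
theorem testBit_wordApplyL_symm {gens : List (List ℕ)} (hgens : ∀ g ∈ gens, permListOK n g = true) (wd : List ℕ)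
    (hw : ∀ g ∈ wd, g < gens.length) (M : ℕ) (y : Fin n) :
    (wordApplyL n gens wd M).testBit y = M.testBit ((wordEquiv n gens wd).symm y) := by
  rw [Bool.eq_iff_iff, testBit_wordApplyL hgens wd hw M y]
  constructor
  · rintro ⟨q, hq, hqy⟩
    have : (wordEquiv n gens wd) q = y := Fin.ext hqy
    rw [← this, Equiv.symm_apply_apply]
    exact hq
  · intro h
    exact ⟨(wordEquiv n gens wd).symm y, h, by rw [Equiv.apply_symm_apply]⟩

/-- Bits of the free mask: bit `j < n` is set iff `j` is a free column. -/
theorem testBit_freeMaskOf (piv : List ℕ) (j : Fin n) : (freeMaskOf n piv).testBit j = isFree piv j := by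
  rw [freeMaskOf, testBit_maskOf, freeIdx]
  simp [List.mem_filter, List.mem_range, j.2, isFree]

/-- The free mask is a word below `2^n`. -/
theorem freeMaskOf_lt (n : ℕ) (piv : List ℕ) : freeMaskOf n piv < 2 ^ n := by
  rw [freeMaskOf]
  apply Nat.lt_pow_two_of_testBit
  intro j hj
  rw [testBit_maskOf, freeIdx]
  simp only [List.mem_filter, List.mem_range, decide_eq_false_iff_not, not_and]
  intro h; omega

/-- `countMasks` as a `countB` over the indices. -/
theorem countMasks_eq (x : ℕ) : ∀ (Ms : List ℕ),
    countMasks Ms x = countB (fun i => (Ms.getD i 0).testBit x) (List.range Ms.length)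
  | [] => rfl
  | M :: Ms => by
    rw [countMasks, countMasks_eq x Ms, List.length_cons, List.range_succ_eq_map, countB_cons, countB_map]
    rfl
where
  /-- `countB` along a mapped list. -/
  countB_map {p : ℕ → Bool} (f : ℕ → ℕ) : ∀ (l : List ℕ), countB p (l.map f) = countB (fun i => p (f i)) l
  | [] => rfl
  | a :: l => by rw [List.map_cons, countB_cons, countB_cons, countB_map f l]

/-- `countB` depends only on the predicate's values on the list. -/
theorem countB_congr (p p' : ℕ → Bool) : ∀ (l : List ℕ), (∀ i ∈ l, p i = p' i) → countB p l = countB p' l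
  | [], _ => rfl
  | a :: l, h => by
    rw [countB_cons, countB_cons, h a (by simp), countB_congr p p' l fun i hi => h i (by simp [hi])]

end MaskLemmas

/-! ## 3. Soundness for an abstract automorphism family -/

section Abstract

variable {n : ℕ} {Hsyn Hstab : List ℕ}

/-- **The orbit-averaging argument for an abstract family.**  `q` automorphisms `σ_i` of both matrices (as row-map
automorphisms), a function `f i` tabulating `σ_i` on `{0,…,n−1}`, views with RREF certificates and replays, a
multiplicity function `mult s x = #{i < q : σ_i x free in view s}` constant on the classes of `cls` with table `μ`, and
the passing profile recursion give: every non-trivial logical has weight `> wmax`.  (Same proof as the landed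
`orbit_lower_sound`, with the transport supplied by hypothesis.) -/
theorem orbit_lower_sound_abs (hcomm : rowMatrix n Hsyn * (rowMatrix n Hstab)ᵀ = 0) {found : List (ℕ × List ℕ)}
    (hfound : foundOK Hstab found = true)
    (q : ℕ) (σ : ℕ → (Fin n ≃ Fin n)) (f : ℕ → ℕ → ℕ) (hf : ∀ i, i < q → ∀ x : Fin n, f i x = ((σ i x : Fin n) : ℕ))
    (hσX : ∀ i, i < q → ∃ ρ : Fin Hsyn.length → Fin Hsyn.length, (rowMatrix n Hsyn).submatrix ρ (σ i) = rowMatrix n Hsyn)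
    (hσZ : ∀ i, i < q →
      ∃ ρ : Fin Hstab.length → Fin Hstab.length, (rowMatrix n Hstab).submatrix ρ (σ i) = rowMatrix n Hstab)
    {views : List OrbitView}
    (hviews : ∀ s, s < views.length → infoSetStructOK n Hsyn (views.getD s dfltView).ic = true)
    {wmax : ℕ}
    (hreach : ∀ s, s < views.length → Reaches (bzLeaf wmax (found.map Prod.fst))
      (rowPos (kerBasis n (views.getD s dfltView).ic.piv (views.getD s dfltView).ic.red) 0)
      (views.getD s dfltView).t 0 0)
    (mult : ℕ → ℕ → ℕ)
    (hmult : ∀ s, s < views.length → ∀ x : Fin n,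
      mult s x = countB (fun i => isFree (views.getD s dfltView).ic.piv (f i x)) (List.range q))
    {cls : List ℕ} {μ : List (List ℕ)}
    (hcls : ∀ x, x < n → cls.getD x 0 < μ.length ∧
      ∀ s, s < views.length → mult s x = (μ.getD (cls.getD x 0) []).getD s 0)
    (hgo : profGo μ (classSizes n μ.length cls) wmax 0 (List.replicate views.length 0) (orbBounds q views) = true)
    (w : Fin n → ZMod 2) (hw : rowMatrix n Hsyn *ᵥ w = 0) (hw' : w ∉ rowSpace (rowMatrix n Hstab)) :
    wmax < hammingNorm w := by
  by_contra hle
  rw [not_lt] at hle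
  -- the support
  set L := suppIdx n w with hL
  have hLlen : L.length = hammingNorm w := by
    have := length_suppList n [] w
    rwa [suppList, List.length_map] at this
  have hw0 : w ≠ 0 := fun h0 => hw' (h0 ▸ Submodule.zero_mem _)
  have hLpos : 0 < L.length := by rw [hLlen]; exact hammingNorm_pos_iff.2 hw0
  have hLlt : ∀ x ∈ L, x < n := fun x hx => lt_of_mem_suppIdx n w hx
  have hLsub : L.Sublist (List.range n) := by
    rw [hL, suppIdx, ← List.map_coe_finRange_eq_range]
    exact (List.filter_sublist).map _
  -- the class profile of the support
  set m := μ.length with hm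
  set ps := profileOf cls m L with hps
  have hclsL : ∀ x ∈ L, cls.getD x 0 < m := fun x hx => (hcls x (hLlt x hx)).1
  have hpslen : ps.length = μ.length := length_profileOf cls m L
  have hpssum : ps.sum = L.length := sum_profileOf cls m L hclsL
  have hpscap : ∀ j, j < μ.length → ps.getD j 0 ≤ (classSizes n m cls).getD j 0 := by
    intro j hj
    rw [hps, getD_profileOf _ _ _ hj, classSizes, List.getD_eq_getElem?_getD, List.getElem?_map,
      List.getElem?_range hj, Option.map_some, Option.getD_some]
    exact countB_le_of_sublist _ hLsub
  rcases profGo_sound μ (classSizes n m cls) wmax 0 (List.replicate views.length 0) (orbBounds q views) hgo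
      ps hpslen hpscap (by rw [hpssum, hLlen]; exact hle) with h0 | ⟨s, hs1, hs2, hlt⟩
  · omega
  rw [List.length_replicate] at hs1
  set V := views.getD s dfltView with hV
  have hacc : (List.replicate views.length 0).getD s 0 = 0 := by
    rw [List.getD_eq_getElem?_getD, List.getElem?_replicate, if_pos hs1, Option.getD_some]
  have hbnd : (orbBounds q views).getD s 0 = q * (V.t + 1) := by
    rw [orbBounds, List.getD_eq_getElem?_getD, List.getElem?_map, List.getElem?_eq_getElem hs1, Option.map_some,
      Option.getD_some, hV, List.getD_eq_getElem?_getD, List.getElem?_eq_getElem hs1, Option.getD_some]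
  rw [hacc, hbnd, zero_add] at hlt
  -- Σ_{x ∈ L} mult s x = Σ_j p_j μ[j][s]
  have hsumL : (L.map fun x => mult s x).sum = profSum ps μ s := by
    rw [sum_map_eq_profSum_aux cls m (fun x => mult s x) (fun j => (μ.getD j []).getD s 0) L hclsL
      (fun x hx => (hcls x (hLlt x hx)).2 s hs1), profSum]
    refine congrArg List.sum (List.map_congr_left fun j hj => ?_)
    rw [List.mem_range] at hj
    rw [hps, getD_profileOf _ _ _ hj]
  -- double count
  have hswap := sum_countB_swap (fun i x => isFree V.ic.piv (f i x)) (List.range q) L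
  have hmultL : ∀ x ∈ L, mult s x = countB (fun i => isFree V.ic.piv (f i x)) (List.range q) := fun x hx => by
    have := hmult s hs1 ⟨x, hLlt x hx⟩
    rw [← hV] at this
    exact this
  have hlt' : ((List.range q).map fun i => countB (fun x => isFree V.ic.piv (f i x)) L).sum <
      (List.range q).length * (V.t + 1) := by
    rw [hswap, List.length_range, ← List.map_congr_left hmultL, hsumL]
    exact hlt
  obtain ⟨i, hi, hile⟩ := exists_le_of_sum_lt _ V.t (List.range q) hlt'
  rw [List.mem_range] at hi
  -- transport by σ_i
  let C : CSSCode (Fin Hsyn.length) (Fin Hstab.length) (Fin n) :=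
    CSSCode.ofMatrices (rowMatrix n Hsyn) (rowMatrix n Hstab) hcomm
  obtain ⟨ρX, hXsub⟩ := hσX i hi
  obtain ⟨ρZ, hZsub⟩ := hσZ i hi
  obtain ⟨hz1, hz2⟩ := C.zLogical_comp_equiv_symm_of_rowMap hXsub hZsub ⟨hw, hw'⟩
  have hz3 : hammingNorm (w ∘ (σ i).symm) = hammingNorm w := hammingNorm_comp_equiv w _
  set w' := w ∘ (σ i).symm with hw'Def
  have hfree : (freeSupp n V.ic.piv w').length ≤ V.t := by
    rw [hw'Def, length_freeSupp_comp_symm V.ic.piv (σ i) w (f i) (hf i hi)]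
    exact hile
  -- decomposition over the kernel basis of view `s`
  have hI := hviews s hs1
  rw [← hV] at hI
  simp only [infoSetStructOK, Bool.and_eq_true] at hI
  have hdec := eq_ofBits_freeSupp (Hsyn := Hsyn) hI.1 hI.2 hz1
  set S' := (freeSupp n V.ic.piv w').map (kerVec V.ic.piv V.ic.red) with hS'
  have hS'sub : S'.Sublist (kerBasis n V.ic.piv V.ic.red) := freeSupp_map_sublist_kerBasis w'
  have hS'ne : S' ≠ [] := by
    intro he
    rw [he, xorList, ofBits_zero] at hdec
    exact hz2 (hdec ▸ Submodule.zero_mem _)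
  have hS'len : S'.length ≤ V.t := by rw [hS', List.length_map]; exact hfree
  have hS'lt : xorList S' < 2 ^ n := by
    refine xorList_lt n S' fun x hx => ?_
    rw [hS', List.mem_map] at hx
    obtain ⟨j, hj, rfl⟩ := hx
    exact kerVec_lt_two_pow hI.1 (lt_of_mem_freeSupp w' hj)
  obtain ⟨S, hSsub, hSx, hSlen, -, hSne⟩ := exists_rowPos_sublist _ 0 S' hS'sub
  have hreachS := hreach s hs1
  rw [← hV] at hreachS
  have hleaf := hreachS S hSsub (by rw [hSlen]; exact hS'len)
  rw [Nat.zero_xor, Nat.zero_xor, bzLeaf, hSx] at hleaf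
  simp only [Bool.or_eq_true, beq_iff_eq] at hleaf
  rcases hleaf with (h0 | hwt) | hmem
  · exact hSne hS'ne h0
  · have := lt_popc_of_wtGt n wmax _ hS'lt hwt
    rw [← hammingNorm_ofBits, ← hdec, hz3] at this
    omega
  · apply hz2
    rw [hdec]
    obtain ⟨e, he, hex⟩ : ∃ e ∈ found, e.1 = xorList S' := by
      simpa [List.mem_map] using List.mem_of_elem_eq_true hmem
    simp only [foundOK, List.all_eq_true, beq_iff_eq] at hfound
    rw [← hex, ← hfound e he]
    exact ofBits_xorRows_mem_rowSpace n Hstab e.2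

end Abstract

end Summit.Ventures.QEC.Census
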